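import Literature.MathematicalPhysics.QuantumFieldTheory.Balaban1983to89.B7Eq214Flat
import Literature.MathematicalPhysics.QuantumFieldTheory.Balaban1983to89.B7Eq78Linearization

/-!
# `Balaban1983to89.B7Eq214FlatQprime` — T. Bałaban, *Averaging operations for lattice gauge theories*, Commun. Math. Phys. **98**
# (1985) 17–51 [Balaban1985Averaging], (207) and (212)–(214) p. 50 at the flat background `U₀ = 1`: a COMPANION to
# `B7Eq214Flat` — its linear operator `Q′_jλ` (`lamAvg`) IS the tree's `Q′_j` of B9 (3.19) (`B7Eq78Linearization.QprimeIter`)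
# with trivial transporters, has print's collapsed form `Σ_{x∈Bʲ(y)} L^{−jd}λ(x)`, and (213)–(214) hold under print's own
# hypotheses (207) on `λ` ("(176), (177) are satisfied with a constant `4α₄`")

statement-level skeleton of published theorems with citation tags; proofs where landed; nothing here is a claim about the Yang–Mills mass gap

PDF held: `paper:balaban1985-cmp98-averaging` (journal page = PDF page + 16); render `…/1985-cmp98-averaging-p034-x2.png` (p. 50)
read AS AN IMAGE by this seat (2026-08-21); the page is quoted verbatim in `B7Eq214` and `B7Eq214Flat`.

CITATION HEADER (lean-in-tree rule).  lit-balaban SKELETON rows **B7.Eq213** ((213)–(214); file of record `B7Eq214Flat`, unit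
r04, p242702), **B7.Eq212** (the operator `(Q′_jλ)(y) = Σ_{x∈Bʲ(y)} L^{−jd}R(U₀(Γ^{(j)}_{y,x}))λ(x)`, decl of record
`B7Eq78Linearization.QprimeIter`) and **B7.Eq207**.  This file is the companion announced by seat p22 after ruling G.5-18
(PHASE2-TARGETS §G.5): it ADDS to `B7Eq214Flat` — imported, nothing of it restated — the two items its author left open for it
(HOME/STATUS.md 2026-08-21T00:19:47Z: *"`lamAvg` … NOT yet bridged to `B7Eq78Linearization.QprimeIter (zdBlocking d L)` nor to the
closed form Σ_{x∈Bʲ(y)}L^{−jd}λ(x)"*) and the (207)-form of the theorem.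

PRINT (p. 50 [PDF 34], verbatim): *"The assumptions (176), (177) can be reformulated in terms of the functions λ = (1/i) log u′.
If we assume |(D^η_{U₀}λ)(b)| < α₄, |λ(x)| < α₄, λ(x) ∈ 𝔤ᶜ, α₄ sufficiently small, (207) then assumptions (176), (177) are
satisfied with a constant 4α₄ instead of α₄. … Q′_j(u₁, λ, y) = Σ_{x∈Bʲ(y)} L^{−jd}R(U₀(Γ^{(j)}_{y,x}))λ(x) + Σ_{l=0}^{j−1} O(…),
(212) hence Q′_j(u₁, λ, y) = (Q′_jλ)(y) + C′_j(u₁, λ, y), (213) |C′_j(u₁, λ, y)| = O((α₃α₄ + α₄²)Lʲη). (214)"*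

WHAT IS PROVED (no new definition; kernel theorems).
* `sum_blockSites_eq_sum_boxVec` — the block `B(y)`, `y = Lz`: the sites of `QuantumLattice.blockSites L z` are exactly the points
  `Lz + r`, `r ∈ [0,L)ᵈ` (`B7Prop1Explicit.boxVec`), each once (the two block conventions of the tree agree).
* `QprimeIter_one_succ`, **`lamAvg_eq_QprimeIter`** — at `U₀ = 1` (all transporters `R(U₀(Γ)) = 1`) the composite `Q′_j` of
  (3.19) on `zdBlocking d L` is the iterated block mean: `B7Eq214Flat.lamAvg L j λ = QprimeIter (zdBlocking d L) 1 j λ`.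
* **`QprimeIter_one_eq_sum_blockSites`**, `lamAvg_eq_sum_blockSites` — print's collapsed first term of (212):
  `(Q′_jλ)(z) = Σ_{x∈Bʲ(z)} L^{−jd}λ(x)`, `Bʲ(z) = blockSites (L^j) z` (nested blocks (3), `B7BlockGeometry.sum_blockSites_mul`).
* `norm_exp_sub_one_le_two_mul`, `norm_exp_neg_mul_exp_sub_one_le` — "(207) ⇒ (176), (177) with the constant `4α₄`" at `U₀ = 1`
  in the Banach reading WITHOUT `‖1‖ = 1` (`B7Eq214.ineq176_of_207`/`ineq177_of_207` assume `NormOneClass`): `‖e^{a} − 1‖ ≤ 2α`,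
  `‖e^{−a}e^{a′} − 1‖ ≤ 4‖a′ − a‖` for `‖a‖, ‖a′‖ ≤ α ≤ 1/25` (via the bilinear (41) = `B7Prop9Flat.norm_mlog_exp_add_mul_exp_neg_sub_le`).
* **`eq214_flat_of_207`** — (213)–(214) at `U₀ = 1` under (207): for `u′ = e^{λ}` with `‖λ(x)‖ ≤ α₄`, `‖λ(x + e_κ) − λ(x)‖ ≤ α₄η`
  (`|(D^η_{U₀}λ)(b)| ≤ α₄` at `U₀ = 1`), `u₁ ∈ Λ_k(1, α₃)`, `L ≥ 2`, `Lᵏη ≤ 1` and explicit smallness: for all `j ≤ k`, `z`,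
  `‖log ũ′ʲ(z) − (Q′_jλ)(z)‖ ≤ 16·C′_flat·(α₃α₄ + α₄²)·Lʲη` with `Q′_jλ = QprimeIter (zdBlocking d L) 1 j λ` and r04's
  `C′_flat = B7Eq214Flat.Cflat d` — `B7Eq214Flat.eq214_flat` at `α₄ ↦ 4α₄`, `log e^{λ} = λ`, and `lamAvg_eq_QprimeIter`.
READINGS: those of `B7Eq214Flat` ((a) flat background only; Banach reading, `≤` for `<`); (207)'s first condition at `U₀ = 1` reads
`‖λ(b₊) − λ(b₋)‖ ≤ α₄η` (READING (R1) of `B7Eq214`).  Unit `lit-balaban-p22` (PHASE-2 proof seat), HOME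
`run/shared/lean/pub/lit-balaban/`, 2026-08-21.
-/

noncomputable section

open NormedSpace Finset

namespace Literature.MathematicalPhysics.QuantumFieldTheory.Balaban1983to89.B7Eq214FlatQprime

open B7Prop1Explicit MatrixLog B7Eq99Concrete B7Eq84Concrete B7Eq167Flat B7Eq170Flat B7Prop9Flat B7Prop10Flat B7Eq214Flat
open B7Eq78Linearization (Qprime Qprime_apply QprimeIter QprimeIter_zero QprimeIter_succ zdBlocking conjR conjR_apply)
open Literature.MathematicalPhysics.QuantumLattice (blockSites blockBase)
open B7BlockGeometry (sum_blockSites_mul)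
open B7Eq38Remainder (norm_exp_mul_exp_sub_one_le)

export B7Prop1Explicit (Site)

variable {d : ℕ}

/-! ## §1 `Q′_j` at `U₀ = 1`: `lamAvg` = `QprimeIter` with trivial transporters = the mean over `Bʲ(y)` -/

/-- Reindexing `{0, …, L−1}ᵈ` (index set of `QuantumLattice.blockSites`) by `Fin d → Fin L` (index set of `boxVec`). [folklore] -/
private theorem sum_piFinset_range_eq {β : Type*} [AddCommMonoid β] (L : ℕ) (G : (Fin d → ℕ) → β) :
    ∑ t ∈ Fintype.piFinset (fun _ : Fin d => range L), G t = ∑ r : Fin d → Fin L, G (fun i => (r i : ℕ)) :=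
  Finset.sum_bij' (fun t ht => fun i => ⟨t i, mem_range.mp (Fintype.mem_piFinset.mp ht i)⟩)
    (fun r _ => fun i => ((r i : Fin L) : ℕ)) (fun _ _ => mem_univ _)
    (fun r _ => Fintype.mem_piFinset.mpr fun i => mem_range.mpr (r i).isLt) (fun _ _ => rfl) (fun _ _ => rfl)
    (fun _ _ => rfl)

/-- The block `B(y)` of (2)/(78), `y = Lz`: the sites of `QuantumLattice.blockSites L z` are exactly the points `Lz + r`,
`r ∈ [0, L)ᵈ` (`B7Prop1Explicit.boxVec`), each once. [cite: Balaban1985Averaging, (2) p.17 + (78) p.30] -/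
theorem sum_blockSites_eq_sum_boxVec {β : Type*} [AddCommMonoid β] (L : ℕ) (z : Site d) (g : Site d → β) :
    ∑ x ∈ blockSites L z, g x = ∑ r : Fin d → Fin L, g ((L : ℤ) • z + boxVec L r) := by
  have hbase : blockBase L z = (L : ℤ) • z := funext fun i => by simp [blockBase]
  rw [blockSites, sum_image, sum_piFinset_range_eq]
  · rw [hbase]
    rfl
  · intro t _ t' _ h
    funext i
    simpa using congr_fun h i

variable {𝔸 : Type*} [NormedRing 𝔸] [NormedAlgebra ℂ 𝔸] [CompleteSpace 𝔸]

omit [CompleteSpace 𝔸] in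
/-- **(212), the linear term, one step at `U₀ = 1`**: the operator `Q′(V)` of (212) / B9 (3.19) with trivial transporters
`R(U₀(Γ_{y,x})) = 1` is the block mean `Σ_{x∈B(y)} L^{−d}(·)` of (78): `(Q′_{j+1}λ)(z) = Σ_{r∈[0,L)ᵈ} L^{−d}(Q′_jλ)(Lz + r)`.
[cite: Balaban1985Averaging, (212) p.50 + (78) p.30] -/
theorem QprimeIter_one_succ (L : ℕ) (lam : Site d → 𝔸) (j : ℕ) (z : Site d) :
    QprimeIter (zdBlocking d L) (fun _ _ _ => (1 : 𝔸ˣ)) (j + 1) lam z =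
      bmean L (fun r => QprimeIter (zdBlocking d L) (fun _ _ _ => (1 : 𝔸ˣ)) j lam ((L : ℤ) • z + boxVec L r)) := by
  have hB : (zdBlocking d L).B j z = blockSites L z := rfl
  have hwt : ∀ x, (zdBlocking d L).wt j z x = ((L : ℝ) ^ d)⁻¹ := fun _ => rfl
  rw [QprimeIter_succ, Qprime_apply, bmean_apply]
  simp only [hB, hwt, conjR_apply, Units.val_one, inv_one, one_mul, mul_one]
  exact sum_blockSites_eq_sum_boxVec L z _

omit [CompleteSpace 𝔸] in
/-- **The bridge**: the flat linear average `Q′_jλ` of `B7Eq214Flat` (`lamAvg`, the `j`-fold `L`-block mean) IS the tree's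
`Q′_j` of B9 (3.19) / (212) (`B7Eq78Linearization.QprimeIter`, the decl of record of row B7.Eq212) on the `ℤᵈ` blocking with
the trivial transporters of the flat background. [cite: Balaban1985Averaging, (212)–(213) p.50] -/
theorem lamAvg_eq_QprimeIter (L : ℕ) (lam : Site d → 𝔸) :
    ∀ (j : ℕ) (z : Site d), lamAvg L j lam z = QprimeIter (zdBlocking d L) (fun _ _ _ => (1 : 𝔸ˣ)) j lam z := by
  intro j
  induction j with
  | zero => intro z; rfl
  | succ j ih =>
    intro z
    rw [lamAvg_succ, QprimeIter_one_succ]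
    exact congrArg (bmean L) (funext fun r => ih _)

omit [CompleteSpace 𝔸] in
/-- **(212), the linear term, collapsed** ("`Q′_j(u₁, λ, y) = Σ_{x∈Bʲ(y)} L^{−jd}R(U₀(Γ^{(j)}_{y,x}))λ(x) + …`"): at `U₀ = 1` the `j`-fold
composite is the plain mean over the `Lʲ`-block, `(Q′_jλ)(z) = Σ_{x∈Bʲ(z)} L^{−jd}λ(x)`, `Bʲ(z) = blockSites (L^j) z` (nested blocks (3),
`B7BlockGeometry.sum_blockSites_mul`). [cite: Balaban1985Averaging, (212) p.50 + (3) p.17] -/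
theorem QprimeIter_one_eq_sum_blockSites {L : ℕ} (hL : 1 ≤ L) (lam : Site d → 𝔸) :
    ∀ (j : ℕ) (z : Site d), QprimeIter (zdBlocking d L) (fun _ _ _ => (1 : 𝔸ˣ)) j lam z =
      ∑ x ∈ blockSites (L ^ j) z, (((L : ℝ) ^ (j * d))⁻¹) • lam x := by
  intro j
  induction j with
  | zero =>
    intro z
    rw [QprimeIter_zero, pow_zero, zero_mul, pow_zero, inv_one, sum_blockSites_eq_sum_boxVec]
    simp only [one_smul, Nat.cast_one]
    rw [Fintype.sum_eq_single (fun _ => (0 : Fin 1))]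
    · have h0 : boxVec 1 (fun _ : Fin d => (0 : Fin 1)) = (0 : Site d) := funext fun κ => by simp [boxVec]
      rw [h0, add_zero]
    · exact fun r hr => absurd (funext fun κ => Subsingleton.elim _ _) hr
  | succ j ih =>
    intro z
    have hLpos : 0 < L := hL
    have hB : (zdBlocking d L).B j z = blockSites L z := rfl
    have hwt : ∀ x, (zdBlocking d L).wt j z x = ((L : ℝ) ^ d)⁻¹ := fun _ => rfl
    rw [QprimeIter_succ, Qprime_apply, pow_succ, sum_blockSites_mul (L ^ j) L (pow_pos hLpos j) hLpos]
    simp only [hB, hwt, conjR_apply, Units.val_one, inv_one, one_mul, mul_one, ih, smul_sum, smul_smul]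
    refine sum_congr rfl fun x _ => sum_congr rfl fun w _ => ?_
    rw [← mul_inv, ← pow_add, Nat.succ_mul, add_comm]

omit [CompleteSpace 𝔸] in
/-- Hence `B7Eq214Flat.lamAvg L j λ z = Σ_{x∈Bʲ(z)} L^{−jd}λ(x)` — the printed `(Q′_jλ)(y)` of (212)–(213) at `U₀ = 1`.
[cite: Balaban1985Averaging, (212)–(213) p.50] -/
theorem lamAvg_eq_sum_blockSites {L : ℕ} (hL : 1 ≤ L) (lam : Site d → 𝔸) (j : ℕ) (z : Site d) :
    lamAvg L j lam z = ∑ x ∈ blockSites (L ^ j) z, (((L : ℝ) ^ (j * d))⁻¹) • lam x := by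
  rw [lamAvg_eq_QprimeIter, QprimeIter_one_eq_sum_blockSites hL]

/-! ## §2 "(207) ⇒ (176), (177) with a constant `4α₄`" at `U₀ = 1`, Banach reading without `‖1‖ = 1` -/

/-- **(207) ⇒ (176)** at `U₀ = 1`: `‖e^{a} − 1‖ ≤ e^{α} − 1 ≤ 2α` for `‖a‖ ≤ α ≤ 1` (so `|u′(x) − 1| ≤ 2α₄ ≤ 4α₄` for `u′ = e^{λ}`,
`|λ(x)| ≤ α₄`). [cite: Balaban1985Averaging, (207) p.50 + (176) p.45] -/
theorem norm_exp_sub_one_le_two_mul {a : 𝔸} {α : ℝ} (ha : ‖a‖ ≤ α) (hα : α ≤ 1) : ‖exp a - 1‖ ≤ 2 * α :=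
  (B7Transfer.norm_exp_sub_one_le_of_le a ha).trans (exp_sub_one_le_two_mul_of_le ((norm_nonneg a).trans ha) le_rfl hα)

/-- **(207) ⇒ (177) with `4α₄`** at `U₀ = 1` (print (210): "`A_b = (1/i) log e^{−iλ(b₋)}e^{iλ(b₋)+i(D_{V₀}λ)(b)} = (D_{V₀}λ)(b) +
O(α₄α′₄ + α′₄²)`"): for `‖a‖, ‖a′‖ ≤ α ≤ 1/25`, `‖e^{−a}e^{a′} − 1‖ ≤ 4‖a′ − a‖` — by the bilinear (41) `log(e^{X+Y}e^{−Y}) = X + O(|X||Y|)`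
with `X = a′ − a`, `Y = −a′`, and `|W − 1| ≤ 2|log W|`; so `u′ = e^{λ}` with `‖λ(b₊) − λ(b₋)‖ ≤ α₄η` satisfies (177) with `4α₄`.
[cite: Balaban1985Averaging, (207) + (210) p.50 + (177) p.45] -/
theorem norm_exp_neg_mul_exp_sub_one_le {a a' : 𝔸} {α : ℝ} (ha : ‖a‖ ≤ α) (ha' : ‖a'‖ ≤ α) (hα : α ≤ 1 / 25) :
    ‖exp (-a) * exp a' - 1‖ ≤ 4 * ‖a' - a‖ := by
  have hα0 : 0 ≤ α := (norm_nonneg a).trans ha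
  have hW : ‖exp (-a) * exp a' - 1‖ ≤ 1 / 2 := by
    have h := norm_exp_mul_exp_sub_one_le (-a) a'
    rw [norm_neg] at h
    have h2 : Real.exp (‖a‖ + ‖a'‖) - 1 ≤ 2 * (2 * α) :=
      exp_sub_one_le_two_mul_of_le (by positivity) (by linarith) (by linarith)
    linarith
  have hX : ‖a' - a‖ ≤ 1 / 10 := (norm_sub_le _ _).trans (by linarith)
  have hY : ‖-a'‖ ≤ 1 / 25 := by rw [norm_neg]; exact ha'.trans hα
  have h41 := norm_mlog_exp_add_mul_exp_neg_sub_le hX hY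
  rw [show a' - a + -a' = -a by abel, neg_neg, norm_neg] at h41
  have h0 := norm_nonneg (a' - a)
  have h3 : 3 * ‖a' - a‖ * ‖a'‖ ≤ ‖a' - a‖ := by nlinarith [mul_le_mul_of_nonneg_left (ha'.trans hα) h0]
  have hlog : ‖mlog (exp (-a) * exp a')‖ ≤ 2 * ‖a' - a‖ := (norm_le_insert' _ (a' - a)).trans (by linarith)
  exact (norm_sub_one_le_two_mul_norm_mlog hW).trans (by linarith)

/-! ## §3 (213)–(214) at `U₀ = 1` under print's hypotheses (207) on `λ` -/

/-- **(213)–(214) at the flat background under (207)** (p. 50: *"If we assume |(D^η_{U₀}λ)(b)| < α₄, |λ(x)| < α₄ … (207) then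
assumptions (176), (177) are satisfied with a constant 4α₄ instead of α₄ … hence Q′_j(u₁, λ, y) = (Q′_jλ)(y) + C′_j(u₁, λ, y), (213)
|C′_j(u₁, λ, y)| = O((α₃α₄ + α₄²)Lʲη). (214)"*): with `U₀ = 1`, `L ≥ 2`, `u′ = e^{λ}` for `λ : ℤᵈ → 𝔸` with `‖λ(x)‖ ≤ α₄` and
`‖λ(x + e_κ) − λ(x)‖ ≤ α₄η` (the `η`-lattice covariant derivative at `U₀ = 1`), `u₁ ∈ Λ_k(1, α₃)` ((166)–(167)), `0 ≤ η`,
`Lᵏη ≤ 1`, and the explicit smallness `0 ≤ α₃ ≤ 1/50`, `0 ≤ α₄`, `200C₅α₄ ≤ 1`, `8·10³(d+1)Lα₄ ≤ 1`, `C₄(α₃ + 4α₄) ≤ 1`: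
for all `j ≤ k`, `z`, `‖log ũ′ʲ(z) − (Q′_jλ)(z)‖ ≤ 16·C′_flat·(α₃α₄ + α₄²)·Lʲη`, `Q′_jλ = QprimeIter (zdBlocking d L) 1 j λ`
(= `Σ_{x∈Bʲ(z)}L^{−jd}λ(x)`), `C′_flat = B7Eq214Flat.Cflat d` — i.e. (213) with `C′_j = log ũ′ʲ − Q′_jλ` and (214) explicit.
Proof: (207) ⇒ (176)/(177) with `4α₄` (§2), `B7Eq214Flat.eq214_flat` at `α₄ ↦ 4α₄`, `log e^{λ(x)} = λ(x)`, `lamAvg_eq_QprimeIter`.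
[cite: Balaban1985Averaging, (207) + (213)–(214) p.50] -/
theorem eq214_flat_of_207 {L : ℕ} (hL : 2 ≤ L) {lam : Site d → 𝔸} {u₁ : Site d → 𝔸ˣ} {k : ℕ} {α₃ α₄ η : ℝ}
    (h207a : ∀ (x : Site d) (κ : Fin d), ‖lam (x + e κ) - lam x‖ ≤ α₄ * η)
    (h207b : ∀ x : Site d, ‖lam x‖ ≤ α₄)
    (hu₁ : InLambda L (1 : Site d → Fin d → 𝔸ˣ) u₁ k α₃ η)
    (hη : 0 ≤ η) (hk : (L : ℝ) ^ k * η ≤ 1) (hα₃ : 0 ≤ α₃) (hα₃' : α₃ ≤ 1 / 50) (hα₄ : 0 ≤ α₄)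
    (hs₁ : 200 * C5 d * α₄ ≤ 1) (hs₂ : 8000 * ((d : ℝ) + 1) * L * α₄ ≤ 1) (hs₃ : C4 d * (α₃ + 4 * α₄) ≤ 1) :
    ∀ j ≤ k, ∀ z : Site d,
      ‖mlog ((util L (fun x => expUnit (lam x)) u₁ j z : 𝔸ˣ) : 𝔸)
          - QprimeIter (zdBlocking d L) (fun _ _ _ => (1 : 𝔸ˣ)) j lam z‖
        ≤ 16 * Cflat d * (α₃ * α₄ + α₄ ^ 2) * ((L : ℝ) ^ j * η) := by
  have hC5 := one_le_C5 (d := d)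
  have hα₄s : α₄ ≤ 1 / 200 := by nlinarith
  -- (207) ⇒ (176), (177) with the constant `4α₄`
  have h176 : SiteBd (fun x => expUnit (lam x)) (4 * α₄) := fun x => by
    show ‖exp (lam x) - 1‖ ≤ 4 * α₄
    exact (norm_exp_sub_one_le_two_mul (h207b x) (by linarith)).trans (by linarith)
  have h177 : BondBd (fun x => expUnit (lam x)) (4 * α₄ * η) := fun x κ => by
    show ‖((((expUnit (lam x))⁻¹ * expUnit (lam (x + e κ)) : 𝔸ˣ)) : 𝔸) - 1‖ ≤ 4 * α₄ * η
    rw [Units.val_mul, val_inv_expUnit, val_expUnit, val_expUnit]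
    refine (norm_exp_neg_mul_exp_sub_one_le (h207b x) (h207b (x + e κ)) (by linarith)).trans ?_
    have := h207a x κ
    linarith
  -- `log e^{λ} = λ`
  have hlog : (fun x => mlog ((((fun x => expUnit (lam x)) x : 𝔸ˣ)) : 𝔸)) = lam :=
    funext fun x => by rw [val_expUnit, mlog_exp_of_le ((h207b x).trans (by linarith))]
  have h := eq214_flat hL h176 h177 hu₁ hη hk hα₃ hα₃' (by positivity) (by nlinarith) (by linarith) hs₃ (by nlinarith)
  intro j hj z
  have hjz := h j hj z
  rw [hlog, lamAvg_eq_QprimeIter] at hjz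
  refine hjz.trans ?_
  have hCf : 0 ≤ Cflat d := by unfold Cflat; positivity
  have ht : 0 ≤ (L : ℝ) ^ j * η := by positivity
  have hβ : α₃ * (4 * α₄) + (4 * α₄) ^ 2 ≤ 16 * (α₃ * α₄ + α₄ ^ 2) := by nlinarith [mul_nonneg hα₃ hα₄]
  calc Cflat d * (α₃ * (4 * α₄) + (4 * α₄) ^ 2) * ((L : ℝ) ^ j * η)
      ≤ Cflat d * (16 * (α₃ * α₄ + α₄ ^ 2)) * ((L : ℝ) ^ j * η) := by gcongr
    _ = 16 * Cflat d * (α₃ * α₄ + α₄ ^ 2) * ((L : ℝ) ^ j * η) := by ring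

end Literature.MathematicalPhysics.QuantumFieldTheory.Balaban1983to89.B7Eq214FlatQprime

end
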